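import Summits.FinalStateConjecture.FinalStateConjecture.Theorems.PhotonSphereChannelsChannelsResolveTameDevelopmentsRTotalEnergyConservation

/-!
# Crux `WindowedShellChannels` (stmt-FinalStateConjecture-14085), line `Sketch`, stub `stub_lostFlux` —
# the flux formula for the lagged forward channel energy

The registered stub `stub_lostFlux` of line `Sketch`, over the Literature vocabulary
`ReggeWheeler.{IsSolution, totalEnergy, exteriorEnergy, channelEnergy, energyDensity}` (curried
`ψ : ℝ → ℝ → ℝ`, `deriv` of slices).  For `V ≥ 0` differentiable and a finite-energy global `C²` solution
`ψ` of `ψ_tt − ψ_xx + Vψ = 0`, for every apex time `t₁ ≥ 0`: the forward channel energy of aperture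
`−t₁ ≤ 0` about `xp` (the energy that stays outside the cone with apex `(t₁, xp)`,
`liminf_{T→∞} ∫_{−t₁+|T| < |x−xp|} e(T,·)`) plus the total influx through the two null edges
`x = xp ± (t − t₁)`, `t > t₁` — kinetic part `(ψ_t ± ψ_x)²`, potential part `Vψ²` — equals the total
energy (all terms in `[0, ∞]`).

Proof (sub-namespace `LostFlux`, Fréchet vocabulary `u : ℝ × ℝ → ℝ` of the `WaveEnergy` files):

* `LostFlux.coneEnergy_eq_influx` — `WaveEnergy.energy_identity_affine` on the cone
  `{t₁ ≤ t ≤ T, |x − xp| ≤ t − t₁}` (ends `α(t) = xp − (t − t₁)`, `β(t) = xp + (t − t₁)`):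
  `∫_{α T}^{β T} e(T,·) = ∫_{t₁}^{T} [(u_t+u_x)² + Vu²](t, β t) + [(u_t−u_x)² + Vu²](t, α t) dt`
  (`m + e = (u_t+u_x)² + Vu²`, `e − m = (u_t−u_x)² + Vu²`, `m = 2u_tu_x`);
* `LostFlux.lintegral_eq_cone_add_exterior` — for `0 ≤ t₁ ≤ T` the line is the disjoint union of
  `[α T, β T]` and `{−t₁ + |T| < |x − xp|}`, so the (conserved, finite) total energy is
  `ofReal (cone energy) + exterior energy` at every time `T ≥ t₁`;
* `LostFlux.tendsto_setLIntegral_Ioc` — monotone convergence `(t₁, T] ↑ (t₁, ∞)`;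
* `LostFlux.flux_identity` — hence the exterior energy is `E − ∫⁻_{(t₁,T]} influx`, converges to
  `E − (total influx)` as `T → ∞`, and its `liminf` plus the total influx is `E`.

The main theorem `stub_lostFlux` is the translation to the curried vocabulary through the dictionary
`WaveEnergy.deriv_slice_fst_eq/snd_eq`, `RW.energyDensity_he`, `RW.IsSolution.fderiv_eq` and the
conservation law `RW.totalEnergy_eq_totalEnergy`.  Standard material [folklore]; no new definitions.
-/

noncomputable section

-- the tree's namespace `Summit.FinalStateConjecture.FinalStateConjecture.Theorems` repeats a component by design
-- (problem directory `Summits/FinalStateConjecture/FinalStateConjecture/…`), as in every landed file of this line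
set_option linter.dupNamespace false

namespace Summit.FinalStateConjecture.FinalStateConjecture.Theorems.WindowedShellChannelsSketch

open Literature.Geometry.Lorentzian Literature.Geometry.Lorentzian.ReggeWheeler Filter Set MeasureTheory
open scoped ENNReal Topology

namespace LostFlux

/-! ### Two measure-theoretic helpers on the line -/

/-- For `0 ≤ t₁ ≤ T` the line is the disjoint union of the closed cone section
`[xp − (T − t₁), xp + (T − t₁)]` and the exterior region `{−t₁ + |T| < |x − xp|}` of aperture `−t₁`; hence
for a continuous nonnegative `f`,
`∫⁻ ofReal ∘ f = ofReal (∫_{xp−(T−t₁)}^{xp+(T−t₁)} f) + ∫⁻_{−t₁+|T| < |x−xp|} ofReal ∘ f`. [folklore] -/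
theorem lintegral_eq_cone_add_exterior {f : ℝ → ℝ} (hf : Continuous f) (hf0 : ∀ x, 0 ≤ f x)
    (xp : ℝ) {t₁ T : ℝ} (ht₁ : 0 ≤ t₁) (hT : t₁ ≤ T) :
    ∫⁻ x, ENNReal.ofReal (f x)
      = ENNReal.ofReal (∫ x in (xp - (T - t₁))..(xp + (T - t₁)), f x)
        + ∫⁻ x in {x : ℝ | -t₁ + |T| < |x - xp|}, ENNReal.ofReal (f x) := by
  have hT0 : 0 ≤ T := ht₁.trans hT
  have hset : {x : ℝ | -t₁ + |T| < |x - xp|} = {x : ℝ | T - t₁ < |x - xp|} := by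
    ext x
    rw [mem_setOf_eq, mem_setOf_eq, abs_of_nonneg hT0, neg_add_eq_sub]
  have hm : MeasurableSet {x : ℝ | T - t₁ < |x - xp|} :=
    (isOpen_lt continuous_const (by fun_prop : Continuous fun x : ℝ => |x - xp|)).measurableSet
  have hdisj : Disjoint (Icc (xp - (T - t₁)) (xp + (T - t₁))) {x : ℝ | T - t₁ < |x - xp|} := by
    rw [Set.disjoint_left]
    rintro x ⟨h1, h2⟩ h3
    rw [mem_setOf_eq, lt_abs] at h3
    rcases h3 with h | h <;> linarith
  have hU : Icc (xp - (T - t₁)) (xp + (T - t₁)) ∪ {x : ℝ | T - t₁ < |x - xp|} = univ := by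
    refine eq_univ_of_forall fun x => ?_
    rcases le_or_gt |x - xp| (T - t₁) with h | h
    · rw [abs_le] at h
      exact Or.inl ⟨by linarith [h.1], by linarith [h.2]⟩
    · exact Or.inr h
  have hpq : xp - (T - t₁) ≤ xp + (T - t₁) := by linarith
  rw [hset, ← setLIntegral_univ (μ := volume), ← hU, lintegral_union hm hdisj,
    setLIntegral_congr (Ioc_ae_eq_Icc (μ := volume) (a := xp - (T - t₁)) (b := xp + (T - t₁))).symm,
    WaveEnergy.lintegral_Ioc_eq_ofReal_intervalIntegral hf hf0 hpq]

/-- Monotone convergence on the exhaustion `(t₁, T] ↑ (t₁, ∞)` (real parameter `T → ∞`):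
`∫⁻_{(t₁,T]} F → ∫⁻_{(t₁,∞)} F`. [folklore] -/
theorem tendsto_setLIntegral_Ioc (F : ℝ → ℝ≥0∞) (t₁ : ℝ) :
    Tendsto (fun T => ∫⁻ t in Ioc t₁ T, F t) atTop (𝓝 (∫⁻ t in Ioi t₁, F t)) := by
  have hmono : Monotone fun T : ℝ => ∫⁻ t in Ioc t₁ T, F t := fun a b hab =>
    lintegral_mono_set (Ioc_subset_Ioc_right hab)
  have hsup : (⨆ T : ℝ, ∫⁻ t in Ioc t₁ T, F t) = ∫⁻ t in Ioi t₁, F t := by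
    refine le_antisymm (iSup_le fun T => lintegral_mono_set Ioc_subset_Ioi_self) ?_
    have hdir : Directed (· ⊆ ·) fun n : ℕ => Ioc t₁ (t₁ + n) :=
      Monotone.directed_le fun i j hij => Ioc_subset_Ioc_right (by simpa using hij)
    rw [← WaveEnergy.iUnion_Ioc_add_nat t₁, setLIntegral_iUnion_of_directed _ hdir]
    exact iSup_le fun n => le_iSup (fun T : ℝ => ∫⁻ t in Ioc t₁ T, F t) (t₁ + n)
  rw [← hsup]
  exact tendsto_atTop_iSup hmono

/-! ### The flux formula in the Fréchet vocabulary -/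

section Frechet

variable {u : ℝ × ℝ → ℝ} {V : ℝ → ℝ}

/-- **Energy inside the cone = influx through its edges.** For a `C²` solution `u` of
`u_tt − u_xx + Vu = 0` (`V` differentiable), energy density `e = u_t² + u_x² + Vu²`, apex `(t₁, xp)` and any
time `T`: `∫_{xp−(T−t₁)}^{xp+(T−t₁)} e(T,·) = ∫_{t₁}^{T} [(u_t+u_x)²(t, xp+(t−t₁)) + (u_t−u_x)²(t, xp−(t−t₁))]
+ [Vu²(t, xp+(t−t₁)) + Vu²(t, xp−(t−t₁))] dt` — `WaveEnergy.energy_identity_affine` with ends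
`xp + t₁ − t`, `xp − t₁ + t`, and `m + e = (u_t+u_x)² + Vu²`, `e − m = (u_t−u_x)² + Vu²`. [folklore] -/
theorem coneEnergy_eq_influx (hu : ContDiff ℝ 2 u) (hV : Differentiable ℝ V)
    (hsol : ∀ z : ℝ × ℝ, fderiv ℝ (fderiv ℝ u) z (1, 0) (1, 0)
      - fderiv ℝ (fderiv ℝ u) z (0, 1) (0, 1) + V z.2 * u z = 0)
    {e : ℝ × ℝ → ℝ}
    (he : ∀ z, e z = (fderiv ℝ u z (1, 0)) ^ 2 + (fderiv ℝ u z (0, 1)) ^ 2 + V z.2 * u z ^ 2)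
    (xp t₁ T : ℝ) :
    ∫ x in (xp - (T - t₁))..(xp + (T - t₁)), e (T, x)
      = ∫ t in t₁..T,
        (((fderiv ℝ u (t, xp + (t - t₁)) (1, 0) + fderiv ℝ u (t, xp + (t - t₁)) (0, 1)) ^ 2
            + (fderiv ℝ u (t, xp - (t - t₁)) (1, 0) - fderiv ℝ u (t, xp - (t - t₁)) (0, 1)) ^ 2)
          + (V (xp + (t - t₁)) * u (t, xp + (t - t₁)) ^ 2
            + V (xp - (t - t₁)) * u (t, xp - (t - t₁)) ^ 2)) := by
  have hm : ∀ z : ℝ × ℝ, (fun z => 2 * fderiv ℝ u z (1, 0) * fderiv ℝ u z (0, 1)) z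
      = 2 * fderiv ℝ u z (1, 0) * fderiv ℝ u z (0, 1) := fun z => rfl
  have key := WaveEnergy.energy_identity_affine hu hV hsol he hm (xp + t₁) (-1) (xp - t₁) 1 t₁ T
  have e1 : xp + t₁ + -1 * T = xp - (T - t₁) := by ring
  have e2 : xp - t₁ + 1 * T = xp + (T - t₁) := by ring
  have e3 : xp + t₁ + -1 * t₁ = xp := by ring
  have e4 : xp - t₁ + 1 * t₁ = xp := by ring
  rw [e1, e2, e3, e4, intervalIntegral.integral_same, sub_zero] at key
  rw [key]
  refine intervalIntegral.integral_congr fun t _ => ?_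
  have e5 : xp - t₁ + 1 * t = xp + (t - t₁) := by ring
  have e6 : xp + t₁ + -1 * t = xp - (t - t₁) := by ring
  simp only [e5, e6, he]
  ring

/-- **The flux formula, Fréchet form.** `V ≥ 0` differentiable, `u` a `C²` solution all of whose time
slices have the same finite energy `E₀ = ∫⁻ e(t,·)`, apex `(t₁, xp)` with `t₁ ≥ 0`:
`liminf_{T→∞} ∫⁻_{−t₁+|T|<|x−xp|} e(T,·) + ∫⁻_{t>t₁} [(u_t+u_x)²(t,xp+(t−t₁)) + (u_t−u_x)²(t,xp−(t−t₁))]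
+ ∫⁻_{t>t₁} [Vu²(t,xp+(t−t₁)) + Vu²(t,xp−(t−t₁))] = E₀`.  Indeed `E₀ = ∫⁻_{(t₁,T]} influx + exterior(T)`
for `T ≥ t₁` (`coneEnergy_eq_influx`, `lintegral_eq_cone_add_exterior`), so the exterior energy is
`E₀ − ∫⁻_{(t₁,T]} influx → E₀ − (total influx)` (`tendsto_setLIntegral_Ioc`, `E₀ < ∞`). [folklore] -/
theorem flux_identity (hu : ContDiff ℝ 2 u) (hV : Differentiable ℝ V) (hV0 : ∀ x, 0 ≤ V x)
    (hsol : ∀ z : ℝ × ℝ, fderiv ℝ (fderiv ℝ u) z (1, 0) (1, 0)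
      - fderiv ℝ (fderiv ℝ u) z (0, 1) (0, 1) + V z.2 * u z = 0)
    {e : ℝ × ℝ → ℝ}
    (he : ∀ z, e z = (fderiv ℝ u z (1, 0)) ^ 2 + (fderiv ℝ u z (0, 1)) ^ 2 + V z.2 * u z ^ 2)
    {E₀ : ℝ≥0∞} (hE₀ : E₀ ≠ ⊤) (hcons : ∀ t, ∫⁻ x, ENNReal.ofReal (e (t, x)) = E₀)
    (xp : ℝ) {t₁ : ℝ} (ht₁ : 0 ≤ t₁) :
    liminf (fun T => ∫⁻ x in {x : ℝ | -t₁ + |T| < |x - xp|}, ENNReal.ofReal (e (T, x))) atTop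
      + (∫⁻ t in Ioi t₁, ENNReal.ofReal
          ((fderiv ℝ u (t, xp + (t - t₁)) (1, 0) + fderiv ℝ u (t, xp + (t - t₁)) (0, 1)) ^ 2
            + (fderiv ℝ u (t, xp - (t - t₁)) (1, 0) - fderiv ℝ u (t, xp - (t - t₁)) (0, 1)) ^ 2))
      + (∫⁻ t in Ioi t₁, ENNReal.ofReal
          (V (xp + (t - t₁)) * u (t, xp + (t - t₁)) ^ 2
            + V (xp - (t - t₁)) * u (t, xp - (t - t₁)) ^ 2))
      = E₀ := by
  have hec := WaveEnergy.continuous_energyDensity hu hV he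
  have he0 := WaveEnergy.energyDensity_nonneg hV0 he
  have h1 := WaveEnergy.continuous_fderiv_apply hu (1, 0)
  have h2 := WaveEnergy.continuous_fderiv_apply hu (0, 1)
  have hu0 := (WaveEnergy.differentiable_of_contDiff_two hu).continuous
  have hβ : Continuous fun t : ℝ => ((t, xp + (t - t₁)) : ℝ × ℝ) := by fun_prop
  have hα : Continuous fun t : ℝ => ((t, xp - (t - t₁)) : ℝ × ℝ) := by fun_prop
  -- the kinetic and the potential influx densities
  obtain ⟨k, hk⟩ : ∃ k : ℝ → ℝ, ∀ t, k t
      = (fderiv ℝ u (t, xp + (t - t₁)) (1, 0) + fderiv ℝ u (t, xp + (t - t₁)) (0, 1)) ^ 2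
        + (fderiv ℝ u (t, xp - (t - t₁)) (1, 0) - fderiv ℝ u (t, xp - (t - t₁)) (0, 1)) ^ 2 :=
    ⟨_, fun _ => rfl⟩
  obtain ⟨p, hp⟩ : ∃ p : ℝ → ℝ, ∀ t, p t
      = V (xp + (t - t₁)) * u (t, xp + (t - t₁)) ^ 2
        + V (xp - (t - t₁)) * u (t, xp - (t - t₁)) ^ 2 :=
    ⟨_, fun _ => rfl⟩
  have hkc : Continuous k := by
    rw [show k = _ from funext hk]
    exact (((h1.comp hβ).add (h2.comp hβ)).pow 2).add (((h1.comp hα).sub (h2.comp hα)).pow 2)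
  have hpc : Continuous p := by
    rw [show p = _ from funext hp]
    have hb : Continuous fun t : ℝ => xp + (t - t₁) := by fun_prop
    have ha : Continuous fun t : ℝ => xp - (t - t₁) := by fun_prop
    exact ((hV.continuous.comp hb).mul ((hu0.comp hβ).pow 2)).add
      ((hV.continuous.comp ha).mul ((hu0.comp hα).pow 2))
  have hk0 : ∀ t, 0 ≤ k t := fun t => by
    rw [hk]
    positivity
  have hp0 : ∀ t, 0 ≤ p t := fun t => by
    rw [hp]
    exact add_nonneg (mul_nonneg (hV0 _) (sq_nonneg _)) (mul_nonneg (hV0 _) (sq_nonneg _))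
  simp_rw [← hk, ← hp]
  -- merge the two influx terms into one `lintegral` of the density `k + p`
  have hmeas : Measurable fun t => ENNReal.ofReal (k t) :=
    ENNReal.measurable_ofReal.comp hkc.measurable
  have hadd : (∫⁻ t in Ioi t₁, ENNReal.ofReal (k t) + ENNReal.ofReal (p t))
      = ∫⁻ t in Ioi t₁, ENNReal.ofReal (k t + p t) :=
    lintegral_congr fun t => (ENNReal.ofReal_add (hk0 t) (hp0 t)).symm
  rw [add_assoc, ← lintegral_add_left hmeas, hadd]
  have hFc : Continuous fun t => k t + p t := hkc.add hpc
  have hF0 : ∀ t, 0 ≤ k t + p t := fun t => add_nonneg (hk0 t) (hp0 t)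
  -- the identity `E₀ = ∫⁻_{(t₁,T]} (k + p) + exterior(T)` at every time `T ≥ t₁`
  have hsplit : ∀ T, t₁ ≤ T → E₀ = (∫⁻ t in Ioc t₁ T, ENNReal.ofReal (k t + p t))
      + ∫⁻ x in {x : ℝ | -t₁ + |T| < |x - xp|}, ENNReal.ofReal (e (T, x)) := fun T hT => by
    rw [← hcons T, lintegral_eq_cone_add_exterior (f := fun x => e (T, x))
        (hec.comp (Continuous.prodMk_right T)) (fun x => he0 (T, x)) xp ht₁ hT,
      coneEnergy_eq_influx hu hV hsol he xp t₁ T,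
      WaveEnergy.lintegral_Ioc_eq_ofReal_intervalIntegral hFc hF0 hT]
    simp_rw [← hk, ← hp]
  -- monotone convergence of the truncated influx, finiteness, and the limit of the exterior energy
  have hAt : Tendsto (fun T => ∫⁻ t in Ioc t₁ T, ENNReal.ofReal (k t + p t)) atTop
      (𝓝 (∫⁻ t in Ioi t₁, ENNReal.ofReal (k t + p t))) :=
    tendsto_setLIntegral_Ioc (fun t => ENNReal.ofReal (k t + p t)) t₁
  have hle : (∫⁻ t in Ioi t₁, ENNReal.ofReal (k t + p t)) ≤ E₀ := by
    refine le_of_tendsto hAt ?_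
    filter_upwards [eventually_ge_atTop t₁] with T hT
    rw [hsplit T hT]
    exact le_self_add
  have hfin : ∀ T, (∫⁻ t in Ioc t₁ T, ENNReal.ofReal (k t + p t)) ≠ ⊤ := fun T =>
    ne_top_of_le_ne_top hE₀ ((lintegral_mono_set Ioc_subset_Ioi_self).trans hle)
  have hext : Tendsto (fun T => ∫⁻ x in {x : ℝ | -t₁ + |T| < |x - xp|}, ENNReal.ofReal (e (T, x)))
      atTop (𝓝 (E₀ - ∫⁻ t in Ioi t₁, ENNReal.ofReal (k t + p t))) := by
    refine (ENNReal.Tendsto.sub tendsto_const_nhds hAt (Or.inl hE₀)).congr' ?_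
    filter_upwards [eventually_ge_atTop t₁] with T hT
    exact ENNReal.sub_eq_of_eq_add_rev (hfin T) (hsplit T hT)
  rw [hext.liminf_eq, tsub_add_cancel_of_le hle]

end Frechet

end LostFlux

/-- **Flux formula for the lagged forward channel energy** (registered stub `stub_lostFlux` of line
`Sketch`, crux stmt-FinalStateConjecture-14085).  For `V ≥ 0` differentiable and a finite-energy global
`C²` solution `ψ` of `ψ_tt − ψ_xx + Vψ = 0`, for every apex time `t₁ ≥ 0`: the forward channel energy of
aperture `−t₁` about `xp` (the energy that stays outside the cone with apex `(t₁, xp)`) plus the total energy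
flux through the two null edges `x = xp ± (t − t₁)`, `t > t₁`, of that cone — kinetic part
`(ψ_t + ψ_x)²(t, xp+(t−t₁)) + (ψ_t − ψ_x)²(t, xp−(t−t₁))` and potential part
`Vψ²(t, xp+(t−t₁)) + Vψ²(t, xp−(t−t₁))` — is the total energy.  Proof: `LostFlux.flux_identity` through the
dictionary `WaveEnergy.deriv_slice_fst_eq/snd_eq`, `RW.energyDensity_he`, `RW.IsSolution.fderiv_eq` and
energy conservation `RW.totalEnergy_eq_totalEnergy`. [folklore] -/
theorem stub_lostFlux (V : ℝ → ℝ) (xp : ℝ) (hV : Differentiable ℝ V) (hV0 : ∀ x, 0 ≤ V x)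
    (ψ : ℝ → ℝ → ℝ) (hψ : IsSolution V ψ) (hE : totalEnergy V ψ 0 ≠ ⊤) (t₁ : ℝ) (ht₁ : 0 ≤ t₁) :
    channelEnergy V xp (-t₁) ψ atTop
      + (∫⁻ t in Ioi t₁, ENNReal.ofReal
        ((deriv (fun τ => ψ τ (xp + (t - t₁))) t + deriv (ψ t) (xp + (t - t₁))) ^ 2
          + (deriv (fun τ => ψ τ (xp - (t - t₁))) t - deriv (ψ t) (xp - (t - t₁))) ^ 2))
      + (∫⁻ t in Ioi t₁, ENNReal.ofReal
        (V (xp + (t - t₁)) * ψ t (xp + (t - t₁)) ^ 2 + V (xp - (t - t₁)) * ψ t (xp - (t - t₁)) ^ 2))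
    = totalEnergy V ψ 0 := by
  have he := RW.energyDensity_he (V := V) hψ.1
  have hsol := RW.IsSolution.fderiv_eq hψ
  have hcons : ∀ t, ∫⁻ x, ENNReal.ofReal ((fun z : ℝ × ℝ => energyDensity V ψ z.1 z.2) (t, x))
      = totalEnergy V ψ 0 := fun t => RW.totalEnergy_eq_totalEnergy hV hV0 hψ t 0
  have key := LostFlux.flux_identity hψ.1 hV hV0 hsol he hE hcons xp ht₁
  simp only [Function.uncurry_apply_pair] at key
  have h1 : ∀ t, ENNReal.ofReal
      ((deriv (fun τ => ψ τ (xp + (t - t₁))) t + deriv (ψ t) (xp + (t - t₁))) ^ 2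
        + (deriv (fun τ => ψ τ (xp - (t - t₁))) t - deriv (ψ t) (xp - (t - t₁))) ^ 2)
      = ENNReal.ofReal
      ((fderiv ℝ (Function.uncurry ψ) (t, xp + (t - t₁)) (1, 0)
          + fderiv ℝ (Function.uncurry ψ) (t, xp + (t - t₁)) (0, 1)) ^ 2
        + (fderiv ℝ (Function.uncurry ψ) (t, xp - (t - t₁)) (1, 0)
          - fderiv ℝ (Function.uncurry ψ) (t, xp - (t - t₁)) (0, 1)) ^ 2) := fun t => by
    simp only [WaveEnergy.deriv_slice_fst_eq hψ.1, WaveEnergy.deriv_slice_snd_eq hψ.1]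
  unfold channelEnergy exteriorEnergy
  simp_rw [h1]
  exact key

end Summit.FinalStateConjecture.FinalStateConjecture.Theorems.WindowedShellChannelsSketch

end
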